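/-
Copyright (c) 2026 the pub-hodgecm-mathlib formalisation cell (harness21).  Prover seat hodgecm-mathlib-K2E2-p13 (g2),
Track B «K2-LIT» ∕ h413 (stmt-HodgeConjecture-24833), line K2_E2 «ThetaExhaustionByRigidity», unit CAPTURE, socket #20a «ARCH-PAIR-HOLCOT»
(road b2, line lead K2E2-p12 (g2)), helper H3 «(E) + ≠ 0 for the transported archimedean vector».  KERNEL module: THEOREMS ONLY
(no definition, no named fact, no `sorry`, no instance, no notation).  2026-09-03.
-/
import Summits.HodgeConjecture.HodgeConjecture.Theorems.H413ChiNArchPin                 -- ★ model centre row `cmArchWeilRep_one_blockFamilyOfAt_eq_inv_twistChar_smul`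
import Summits.HodgeConjecture.HodgeCM.Model.HypCensus.ArchFactor_1                     -- ★ `archWeilRep`, `archProdHom`, `hfin_pairSplitting_arch`
import Literature.NumberTheory.GelbartRogawski1991.UnitaryDualPairThetaKernelTwist      -- ★ `pairMap`, `pairSplitting_twist`
import HarnessLib

/-!
# K2_E2 road (h413 = stmt-HodgeConjecture-24833), unit CAPTURE, socket #20a «ARCH-PAIR-HOLCOT», helper H3:
# the archimedean `U(W)`-torus FIXES the engine's harmonic family under the `μ`-splitting (row (E)), and the family is non-zero

Cell `pub/hodgecm-mathlib` (D-0151), Track B (21-frontier RULING «PUSH BOTH» 2026-09-03; chair K2-lead; dealer K2E2-plan (g2) DEAL 23:27:26Z (β);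
line lead K2E2-p12 (g2) STRUCTURE 23:32:20Z, H3).  Socket of record: `Capture.sig_K2E2CapArchPairHolCot` (#20a, `Cruxes/H413/Lines/K2_E2_ThetaExhaustionByRigidity_Capture.lean`
ED. 5), whose conjuncts at the packaged frame `(frameD V, ⟨a⟩)` are (HOLCOT) ∧ `R^∞φ_{j₀} ≠ 0` ∧ (E); this file pays the last two for the archimedean vector the
line lead transports — the engine's harmonic block family `Φ_∞(ℓ) = blockFamilyOfAt … ℓ` of ★ `F0P2sThetaOccursInEngineGen.exists_holTheta_atFrame_of_chiN` —
in the MODEL's Gram spelling `(diagonal (frameD V), diagonal (lineVec a))` where both ★ inputs live (the cast to the line's `(TW a, JW a, chiSplittingLine)` is the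
line lead's H1 cast, ★ `Def411WeilCarriersDoubling.chiSplittingLine = splittingCongr … (chiSplitting … (lineW T_W) …)`).

THE MATHEMATICS (the dealer's «falsifier first»: the centre exponent is ZERO).  Liu's `μ`-splitting `ι_μ = chiSplitting(μ)` of the pair `U(V) × U(⟨a⟩)` and the
model's splitting of record `s₀ = splittingOf hGR` differ by an automorphic character `ĉ` of `G₁(𝔸) = U(V ⊗ W)(𝔸)`: `ι_μ = s₀ ⊗ ĉ` ([GelbartRogawski1991, §3.1 Remark
p. 457]; the binder `htw`).  (1) ★ `ThetaDistAtLine.cmArchWeilRep_one_blockFamilyOfAt_eq_inv_twistChar_smul`: for `μ` conjugate-symplectic OF WEIGHT ONE at a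
`μ`-ADMISSIBLE line with `(mk ι₁).embedding ∈ Φ_μ`, the archimedean `U(W)`-torus acts on `Φ_∞(ℓ)` through `s₀` by `(ĉ ∘ ι_W)⁻¹`:
`ω_{s₀}(1, a′) Φ_∞(ℓ) = (ĉ (ι_W (a′)_𝔸))⁻¹ • Φ_∞(ℓ)` ([Liu2021, App. D §D.1 Step 3, Lem. D.2]; [KonnoKonno2007, Thm 5.4]; the centre identity (CC₀)).
(2) §1, generic: `ω_ψ((s ⊗ ĉ)_pair p) = ĉ(pairMap p) • ω_ψ(s_pair p)` (★ `pairSplitting_twist`, ★ `adelicMpCont.omega_twist`, definitional) read off on the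
archimedean factor (★ `omega_thinCosetTestFunₗ`, ★ `archRepMp_unique`): `archWeilRep[s ⊗ ĉ] (1, a′) = ĉ(ι_W (a′)_𝔸) • archWeilRep[s] (1, a′)`.
(3) Hence `archWeilRep[ι_μ] (1, a′) Φ_∞(ℓ) = ĉ(x) • ĉ(x)⁻¹ • Φ_∞(ℓ) = Φ_∞(ℓ)`: THE `U(W)`-TORUS FIXES THE HARMONIC FAMILY UNDER THE `μ`-SPLITTING — row (E)
of #20a for this vector, with no sign convention entering (an exact cancellation).  (≠ 0) is ★ `ArchSideTerm.blockFamilyOfAt_degOnePDual_binvPi_one_ne_zero`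
at `ℓ₀ = ⟨e₀, ·⟩`.

* §1 (generic, any quadratic `E/F`, Gram data, splitting `s`, character `ĉ`): `archWeilRep_congr_splitting`, **`archWeilRep_twist_apply`**,
  `pairMap_archProdHom_one_left`, **`archWeilRep_twist_one_left`**.
* §2 (model spelling, binders = ★ (1)'s VERBATIM + any proof `hsμ` of the projection clause of `ι_μ`):
  **`archWeilRep_chiSplitting_one_blockFamilyOfAt_eq_self`** — `archWeilRep[chiSplitting(μ₀)] (1, a′) Φ_∞(ℓ) = Φ_∞(ℓ)`, every `a′`, `ℓ`, slot-sign frame `eR, eS`;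
  **`…_of_admissible`** — the same under the engine's admissible-line binders `(e he hae) (hmem)` (as ★ `F0P2tThetaLiftNeZeroGen`);
  **`archRowE_and_ne_zero_of_admissible`** — (E) ∧ `Φ_∞(ℓ₀) ≠ 0`, the two #20a conjuncts for the transported vector.
No hypothesis is idle: drop weight one ∕ admissibility ∕ the orientation `hι₁` and (CC₀) fails (the centre character of `ι_μ` is then a non-trivial power);
drop `htw` and `ĉ` is unrelated to `ι_μ`.

HONEST LABEL: HC_CM is proved only modulo the 7 printed citations (2 remaining named inputs: hLiu418 = stmt-HodgeConjecture-24832,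
h413 = stmt-HodgeConjecture-24833) until rung 0 closes; this file is a `--supports stmt-HodgeConjecture-24833` helper (H3 of #20a's road b2) and retires
nothing by itself.

## References
* [Liu2021] Y. Liu, *Fourier–Jacobi cycles and arithmetic relative trace formula*, Camb. J. Math. 9 (2021) = arXiv:2102.11518: App. D §D.1 Step 3
  (l. 5219–5221), Lem. D.2 (2); Def. 4.12; proof of Prop. 4.13 «Conversely» (l. 2145–2149).
* [GelbartRogawski1991] S. Gelbart, J. Rogawski, Invent. Math. 105 (1991): §3.1 p. 454–455, Prop. 3.1.1, Remark p. 457 L4–13.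
* [Weil1964] A. Weil, Acta Math. 111 (1964): Chap. III n° 37–38 p. 188–190 (`𝐫_𝐀 = ⊗_v 𝐫_v`).
* [KonnoKonno2007] T. Konno, K. Konno, Kyushu J. Math. 61 (2007): Lemma 5.2, Thm 5.4 p. 75.
-/

set_option autoImplicit false
-- the mandated namespace repeats the single-problem summit's segment (`HodgeConjecture.HodgeConjecture`)
set_option linter.dupNamespace false

noncomputable section

open NumberField NumberField.InfinitePlace IsDedekindDomain
open scoped TensorProduct SchwartzMap Matrix Classical
open Literature.NumberTheory.Automorphic Literature.NumberTheory.Weil1964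
open Literature.NumberTheory.GelbartRogawski1991 Literature.NumberTheory.GelbartRogawski1991.UnitaryDualPair
open HodgeCM.Model.HypCensus

namespace Summit.HodgeConjecture.HodgeConjecture.Cruxes.H413.K2E2CapArchPairFixedNeZero
/-! ## §1 Generic: the archimedean Weil representation of a TWISTED splitting -/

section Generic

variable (F E : Type) [Field F] [NumberField F] [Field E] [NumberField E] [Algebra F E] (c : E ≃ₐ[F] E)
  (N M : ℕ) (JV : Matrix (Fin N) (Fin N) E) (JW : Matrix (Fin M) (Fin M) E)
  [Algebra.IsQuadraticExtension F E] {δ : E} (hcδ : c δ = -δ) (hδ : δ ≠ 0) {d : F} (hd : δ * δ = algebraMap F E d)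
  {TV : Matrix (Fin N) (Fin N) F} {TW : Matrix (Fin M) (Fin M) F}
  (hV : TV.IsSymm) (hW : TW.IsSymm) (hVd : IsUnit TV.det) (hWd : IsUnit TW.det)
  (hJV : JV = TV.map (algebraMap F E)) (hJW : JW = TW.map (algebraMap F E))
  {n : ℕ} (e : Fin N × Fin M ≃ Fin n)
  (s : UnitaryGroup.adelicPair F E c N M JV JW →* adelicMpCont F (Fin n) (adelicGram F e TV TW))
  (hs : ∀ g, adelicMpCont.proj F (Fin n) (adelicGram F e TV TW) (s g) = toSp F E c N M e JV JW hcδ hδ hd hV hW hJV hJW g)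

/-- **Two splittings that are EQUAL give the same archimedean Weil representation** (for any two proofs of the projection clause;
lets a consumer move between a named splitting and its displayed twist form `s = s₀ ⊗ ĉ`). [folklore] -/
theorem archWeilRep_congr_splitting
    {s' : UnitaryGroup.adelicPair F E c N M JV JW →* adelicMpCont F (Fin n) (adelicGram F e TV TW)} (h : s = s')
    (hs' : ∀ g, adelicMpCont.proj F (Fin n) (adelicGram F e TV TW) (s' g) = toSp F E c N M e JV JW hcδ hδ hd hV hW hJV hJW g) :
    archWeilRep F E c N M JV JW hcδ hδ hd hV hW hVd hWd hJV hJW e s hs =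
      archWeilRep F E c N M JV JW hcδ hδ hd hV hW hVd hWd hJV hJW e s' hs' := by
  subst h
  rfl

set_option maxHeartbeats 4000000 in
/-- **The archimedean Weil representation of a twisted splitting**: `archWeilRep[s ⊗ ĉ] (x, y) Φ = ĉ((x_∞ ⊗ 1)(1 ⊗ y_∞)) • archWeilRep[s] (x, y) Φ`
— `ω_ψ((s ⊗ ĉ)_pair p) = ĉ(pairMap p) • ω_ψ(s_pair p)` (★ `pairSplitting_twist`, `omega_twist`, both definitional) read off on the archimedean
factor through the thin-coset test functions (★ `omega_thinCosetTestFunₗ`, `archRepMp_unique`).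
[cite: GelbartRogawski1991, §3.1 p. 454, Remark p. 457 L4–13] [cite: Weil1964, Chap. III n° 37–38 p. 188–190] -/
theorem archWeilRep_twist_apply (ĉ : UnitaryGroup.adelicPair F E c N M JV JW →* ℂˣ)
    (hs' : ∀ g, adelicMpCont.proj F (Fin n) (adelicGram F e TV TW) (adelicMpCont.twist F (Fin n) (adelicGram F e TV TW) s ĉ g) =
      toSp F E c N M e JV JW hcδ hδ hd hV hW hJV hJW g)
    (u : UnitaryGroup.arch F E c N JV × UnitaryGroup.arch F E c M JW) (Φ : 𝓢((Fin n → mixedEmbedding.mixedSpace F), ℂ)) :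
    archWeilRep F E c N M JV JW hcδ hδ hd hV hW hVd hWd hJV hJW e (adelicMpCont.twist F (Fin n) (adelicGram F e TV TW) s ĉ) hs' u Φ =
      ((ĉ (pairMap F E c N M JV JW (archProdHom F E c N M JV JW u)) : ℂˣ) : ℂ) •
        archWeilRep F E c N M JV JW hcδ hδ hd hV hW hVd hWd hJV hJW e s hs u Φ := by
  -- the twisted pair operator is the scalar multiple of the untwisted one (definitional)
  have hω : ∀ Ψ : piSchwartzBruhat F (Fin n),
      adelicMpCont.omega F (Fin n) (adelicGram F e TV TW)
          (((pairSplitting F E c N M e JV JW (adelicMpCont.twist F (Fin n) (adelicGram F e TV TW) s ĉ)).comp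
            (archProdHom F E c N M JV JW)) u) Ψ =
        ((ĉ (pairMap F E c N M JV JW (archProdHom F E c N M JV JW u)) : ℂˣ) : ℂ) •
          adelicMpCont.omega F (Fin n) (adelicGram F e TV TW)
            (((pairSplitting F E c N M e JV JW s).comp (archProdHom F E c N M JV JW)) u) Ψ :=
    fun Ψ => rfl
  -- read off the archimedean parts on thin-coset test functions
  have hA : ∀ Ψ : 𝓢((Fin n → mixedEmbedding.mixedSpace F), ℂ),
      adelicMpCont.omega F (Fin n) (adelicGram F e TV TW)
          (((pairSplitting F E c N M e JV JW (adelicMpCont.twist F (Fin n) (adelicGram F e TV TW) s ĉ)).comp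
            (archProdHom F E c N M JV JW)) u)
          (thinCosetTestFunₗ (K := F) (ι := Fin n) 0 ⊤ Ψ) =
        thinCosetTestFunₗ (K := F) (ι := Fin n) 0 ⊤
          ((((ĉ (pairMap F E c N M JV JW (archProdHom F E c N M JV JW u)) : ℂˣ) : ℂ) •
              archWeilRep F E c N M JV JW hcδ hδ hd hV hW hVd hWd hJV hJW e s hs u) Ψ) := by
    intro Ψ
    rw [hω, LinearMap.smul_apply, map_smul]
    unfold archWeilRep
    rw [omega_thinCosetTestFunₗ]
  have key := archRepMp_unique (H := UnitaryGroup.arch F E c N JV × UnitaryGroup.arch F E c M JW)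
    (Matrix.mulVec_surjective_iff_isUnit.2
      ((Matrix.isUnit_iff_isUnit_det _).2 (UnitaryDualPair.isUnit_det_adelicGram F e hVd hWd)))
    ((pairSplitting F E c N M e JV JW (adelicMpCont.twist F (Fin n) (adelicGram F e TV TW) s ĉ)).comp
      (archProdHom F E c N M JV JW))
    (hfin_pairSplitting_arch F E c N M JV JW hcδ hδ hd hV hW hJV hJW e _ hs') u 0 ⊤ hA
  have := LinearMap.congr_fun key Φ
  rw [LinearMap.smul_apply] at this
  unfold archWeilRep
  rw [archRepMp_apply] at this ⊢
  exact this.symm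

omit [Algebra.IsQuadraticExtension F E] in
/-- `pairMap (archProdHom (1, y)) = ι_W(y_∞)`: the pair element `(1_∞ ⊗ 1)(1 ⊗ y_∞)`. [folklore] -/
theorem pairMap_archProdHom_one_left (y : UnitaryGroup.arch F E c M JW) :
    pairMap F E c N M JV JW (archProdHom F E c N M JV JW (1, y)) =
      UnitaryGroup.adelicInr F E c N M JV JW (UnitaryGroup.archToAdelic F E c M JW y) := by
  have h1 : archProdHom F E c N M JV JW (1, y) = (1, UnitaryGroup.archToAdelic F E c M JW y) :=
    Prod.ext (show UnitaryGroup.archToAdelic F E c N JV 1 = 1 from map_one _) rfl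
  rw [h1, pairMap_apply, map_one, one_mul]

set_option maxHeartbeats 4000000 in
/-- **`archWeilRep[s ⊗ ĉ] (1, y) Φ = ĉ(ι_W(y_∞)) • archWeilRep[s] (1, y) Φ`** — the twist lemma on the `U(W)`-factor.
[cite: GelbartRogawski1991, §3.1 p. 454, Remark p. 457 L4–13] [cite: Weil1964, Chap. III n° 37–38 p. 188–190] -/
theorem archWeilRep_twist_one_left (ĉ : UnitaryGroup.adelicPair F E c N M JV JW →* ℂˣ)
    (hs' : ∀ g, adelicMpCont.proj F (Fin n) (adelicGram F e TV TW) (adelicMpCont.twist F (Fin n) (adelicGram F e TV TW) s ĉ g) =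
      toSp F E c N M e JV JW hcδ hδ hd hV hW hJV hJW g)
    (y : UnitaryGroup.arch F E c M JW) (Φ : 𝓢((Fin n → mixedEmbedding.mixedSpace F), ℂ)) :
    archWeilRep F E c N M JV JW hcδ hδ hd hV hW hVd hWd hJV hJW e (adelicMpCont.twist F (Fin n) (adelicGram F e TV TW) s ĉ) hs' (1, y) Φ =
      ((ĉ (UnitaryGroup.adelicInr F E c N M JV JW (UnitaryGroup.archToAdelic F E c M JW y)) : ℂˣ) : ℂ) •
        archWeilRep F E c N M JV JW hcδ hδ hd hV hW hVd hWd hJV hJW e s hs (1, y) Φ := by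
  rw [archWeilRep_twist_apply F E c N M JV JW hcδ hδ hd hV hW hVd hWd hJV hJW e s hs ĉ hs' (1, y) Φ,
    pairMap_archProdHom_one_left]

end Generic

/-! ## §2 Model spelling: row (E) for the engine's harmonic family under the `μ`-splitting -/

section Model

open HodgeCM HodgeCM.Adelic HodgeCM.PerL34 HodgeCM.Model HodgeCM.Model.ArchSideTerm
open Literature.NumberTheory.GelbartRogawski1991.GRConstruction
open Literature.NumberTheory.Automorphic.Liu2021.Def411WeilCarriersDoubling
open Literature.NumberTheory.Automorphic.IdeleClassGroup
open Literature.NumberTheory.GaloisRepresentations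
open Literature.RepresentationTheory.HarrisKudlaSweet1996
open Literature.Analysis.SegalBargmann
open Literature.AlgebraicGeometry.Liu2021 (IsAdmissibleElement)
open Summit.HodgeConjecture.HodgeConjecture.Cruxes.H413.ThetaDistAtLine

variable {L : CMField} {ι₁ : L →+* ℂ} (V : HermSpace3 L ι₁) (a : (L : Type))
  (ha : IsCMField.complexConj (L : Type) a = a) (ha0 : a ≠ 0)
  (hGR : (cmSplittingDatum (L : Type) e₁ (frameD V) (frameD_real V) (frameD_ne V) (lineVec (L : Type) a) (fun _ => ha)
    (fun _ => ha0)).CompatibleSplitting)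
  (μ₀ : Literature.NumberTheory.Automorphic.IdeleClassGroup (L : Type) →ₜ* Circle) (hμ₀ : IsConjugateSymplectic (L : Type) μ₀)
  (hw : HasWeight (L : Type) μ₀ 1)
  (ĉ : UnitaryGroup.adelicPair (↥(maximalRealSubfield (L : Type))) (L : Type) (IsCMField.complexConj (L : Type)) 3 1 (Matrix.diagonal (frameD V))
    (Matrix.diagonal (lineVec (L : Type) a)) →* ℂˣ)
  (htw : chiSplitting (L : Type) e₁ (frameD V) (frameD_real V) (frameD_ne V) (lineVec (L : Type) a) (fun _ => ha) (fun _ => ha0)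
      (toHeckeCharacter (L : Type) μ₀) (isUnitary_toHeckeCharacter (L : Type) μ₀)
      (isSplittingChar_toHeckeCharacter_of_isConjugateSymplectic (L : Type) μ₀ hμ₀) =
    adelicMpCont.twist (↥(maximalRealSubfield (L : Type))) (Fin 3) _
      (splittingOf (↥(maximalRealSubfield (L : Type))) (L : Type) (IsCMField.complexConj (L : Type)) 3 1 e₁
        (Matrix.diagonal (frameD V)) (Matrix.diagonal (lineVec (L : Type) a)) (complexConj_imagUnit (L : Type)) (imagUnit_ne_zero (L : Type))
        (imagUnit_mul_self (L : Type)) (realDiagonal_isSymm (L : Type) (frameD V) (frameD_real V))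
        (realDiagonal_isSymm (L : Type) (lineVec (L : Type) a) (fun _ => ha))
        (isUnit_det_realDiagonal (L : Type) (frameD V) (frameD_real V) (frameD_ne V))
        (isUnit_det_realDiagonal (L : Type) (lineVec (L : Type) a) (fun _ => ha) (fun _ => ha0))
        (realDiagonal_map (L : Type) (frameD V) (frameD_real V)).symm
        (realDiagonal_map (L : Type) (lineVec (L : Type) a) (fun _ => ha)).symm hGR) ĉ)
  (hsμ : ∀ g, adelicMpCont.proj (↥(maximalRealSubfield (L : Type))) (Fin 3)
      (adelicGram (↥(maximalRealSubfield (L : Type))) e₁ (realDiagonal (L : Type) (frameD V) (frameD_real V))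
        (realDiagonal (L : Type) (lineVec (L : Type) a) (fun _ => ha)))
      (chiSplitting (L : Type) e₁ (frameD V) (frameD_real V) (frameD_ne V) (lineVec (L : Type) a) (fun _ => ha) (fun _ => ha0)
        (toHeckeCharacter (L : Type) μ₀) (isUnitary_toHeckeCharacter (L : Type) μ₀)
        (isSplittingChar_toHeckeCharacter_of_isConjugateSymplectic (L : Type) μ₀ hμ₀) g) =
    toSp (↥(maximalRealSubfield (L : Type))) (L : Type) (IsCMField.complexConj (L : Type)) 3 1 e₁ (Matrix.diagonal (frameD V))
      (Matrix.diagonal (lineVec (L : Type) a)) (complexConj_imagUnit (L : Type)) (imagUnit_ne_zero (L : Type)) (imagUnit_mul_self (L : Type))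
      (realDiagonal_isSymm (L : Type) (frameD V) (frameD_real V)) (realDiagonal_isSymm (L : Type) (lineVec (L : Type) a) (fun _ => ha))
      (realDiagonal_map (L : Type) (frameD V) (frameD_real V)).symm (realDiagonal_map (L : Type) (lineVec (L : Type) a) (fun _ => ha)).symm g)
  {S' : Type} [Fintype S'] [DecidableEq S']
  (eR : PosIdx (cmXW (L : Type) (frameD V) (lineVec (L : Type) a) (fun _ => ha) ι₁ (HypCensus.cmPlace (L : Type) ι₁)) ≃ Unit)
  (eS : NegIdx (cmXW (L : Type) (frameD V) (lineVec (L : Type) a) (fun _ => ha) ι₁ (HypCensus.cmPlace (L : Type) ι₁)) ≃ S')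

/-- the projection clause of the twisted splitting of record `s₀ ⊗ ĉ` (★ `proj_twist` + ★ `proj_cmSplittingOf`). [folklore] -/
theorem proj_twist_splittingOf (g : UnitaryGroup.adelicPair (↥(maximalRealSubfield (L : Type))) (L : Type) (IsCMField.complexConj (L : Type)) 3 1
    (Matrix.diagonal (frameD V)) (Matrix.diagonal (lineVec (L : Type) a))) :
    adelicMpCont.proj (↥(maximalRealSubfield (L : Type))) (Fin 3)
        (adelicGram (↥(maximalRealSubfield (L : Type))) e₁ (realDiagonal (L : Type) (frameD V) (frameD_real V))
          (realDiagonal (L : Type) (lineVec (L : Type) a) (fun _ => ha)))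
        (adelicMpCont.twist (↥(maximalRealSubfield (L : Type))) (Fin 3) _
          (cmSplittingOf (L : Type) e₁ (frameD V) (frameD_real V) (frameD_ne V) (lineVec (L : Type) a) (fun _ => ha) (fun _ => ha0) hGR) ĉ g) =
      toSp (↥(maximalRealSubfield (L : Type))) (L : Type) (IsCMField.complexConj (L : Type)) 3 1 e₁ (Matrix.diagonal (frameD V))
        (Matrix.diagonal (lineVec (L : Type) a)) (complexConj_imagUnit (L : Type)) (imagUnit_ne_zero (L : Type)) (imagUnit_mul_self (L : Type))
        (realDiagonal_isSymm (L : Type) (frameD V) (frameD_real V)) (realDiagonal_isSymm (L : Type) (lineVec (L : Type) a) (fun _ => ha))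
        (realDiagonal_map (L : Type) (frameD V) (frameD_real V)).symm (realDiagonal_map (L : Type) (lineVec (L : Type) a) (fun _ => ha)).symm g :=
  (adelicMpCont.proj_twist _ ĉ g).trans (proj_cmSplittingOf (L : Type) e₁ (frameD V) (frameD_real V) (frameD_ne V) (lineVec (L : Type) a)
    (fun _ => ha) (fun _ => ha0) hGR g)

include hw htw in
set_option synthInstance.maxHeartbeats 400000 in
set_option maxHeartbeats 8000000 in
/-- **ROW (E) FOR THE ENGINE'S HARMONIC FAMILY: the archimedean `U(W)`-torus FIXES `Φ_∞(ℓ) = blockFamilyOfAt … ℓ` under the `μ`-splitting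
`chiSplitting(μ₀)`** — for `μ₀` conjugate-symplectic of weight one with CM type `Φμ` characterised by the admissible line `⟨a⟩` (`hΦ`), oriented by
`(mk ι₁).embedding ∈ Φμ`, and Liu's twist equation `chiSplitting(μ₀) = splittingOf hGR ⊗ ĉ` (`htw`): `archWeilRep[chiSplitting(μ₀)] (1, a′) Φ_∞(ℓ) = Φ_∞(ℓ)`
for every `a′ ∈ U(⟨a⟩)(L⁺ ⊗ ℝ)`, every covector `ℓ`, every slot-sign frame `eR, eS`, and ANY proof `hsμ` of the projection clause.  Proof: §1 twist lemma
(scalar `ĉ(ι_W (a′)_𝔸)`) × ★ centre row `(ĉ (ι_W (a′)_𝔸))⁻¹` (weight one ∕ admissibility ∕ orientation) = `1`.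
[cite: Liu2021, App. D §D.1 Step 3 (l. 5219–5221), Lem. D.2 (2); Def. 4.12] [cite: GelbartRogawski1991, §3.1 p. 454–455, Remark p. 457 L4–13]
[cite: KonnoKonno2007, Thm 5.4 p. 75] [cite: Weil1964, Chap. III n° 37–38 p. 188–190] -/
theorem archWeilRep_chiSplitting_one_blockFamilyOfAt_eq_self {Φμ : Literature.AlgebraicGeometry.Motives.CMType (L : Type)}
    (hΦμ : HasCMType (L : Type) μ₀ Φμ) (hΦ : ∀ φ : (L : Type) →+* ℂ, φ ∈ Φμ.1 ↔ 0 < (φ (imagUnit (L : Type) * a)).im)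
    (hι₁ : (InfinitePlace.mk ι₁).embedding ∈ Φμ.1)
    (a' : UnitaryGroup.arch (↥(maximalRealSubfield L)) (L : Type) (IsCMField.complexConj L) 1 (Matrix.diagonal (lineVec (L : Type) a)))
    (ℓ : Module.Dual ℂ (Fin 2 → ℂ)) :
    archWeilRep (↥(maximalRealSubfield (L : Type))) (L : Type) (IsCMField.complexConj (L : Type)) 3 1 (Matrix.diagonal (frameD V))
        (Matrix.diagonal (lineVec (L : Type) a)) (complexConj_imagUnit (L : Type)) (imagUnit_ne_zero (L : Type)) (imagUnit_mul_self (L : Type))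
        (realDiagonal_isSymm (L : Type) (frameD V) (frameD_real V)) (realDiagonal_isSymm (L : Type) (lineVec (L : Type) a) (fun _ => ha))
        (isUnit_det_realDiagonal (L : Type) (frameD V) (frameD_real V) (frameD_ne V))
        (isUnit_det_realDiagonal (L : Type) (lineVec (L : Type) a) (fun _ => ha) (fun _ => ha0))
        (realDiagonal_map (L : Type) (frameD V) (frameD_real V)).symm (realDiagonal_map (L : Type) (lineVec (L : Type) a) (fun _ => ha)).symm e₁
        (chiSplitting (L : Type) e₁ (frameD V) (frameD_real V) (frameD_ne V) (lineVec (L : Type) a) (fun _ => ha) (fun _ => ha0)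
          (toHeckeCharacter (L : Type) μ₀) (isUnitary_toHeckeCharacter (L : Type) μ₀)
          (isSplittingChar_toHeckeCharacter_of_isConjugateSymplectic (L : Type) μ₀ hμ₀)) hsμ (1, a')
        (blockFamilyOfAt (L : Type) e₁ (frameD V) (frameD_real V) (frameD_ne V) (lineVec (L : Type) a) (fun _ => ha) (fun _ => ha0) ι₁
          (blockPosEquiv V) (blockNegEquiv V) eR eS (degOnePDual S') (binvPi 1) ℓ) =
      blockFamilyOfAt (L : Type) e₁ (frameD V) (frameD_real V) (frameD_ne V) (lineVec (L : Type) a) (fun _ => ha) (fun _ => ha0) ι₁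
        (blockPosEquiv V) (blockNegEquiv V) eR eS (degOnePDual S') (binvPi 1) ℓ := by
  -- move to the displayed twist form `s₀ ⊗ ĉ` of the `μ`-splitting
  rw [archWeilRep_congr_splitting (↥(maximalRealSubfield (L : Type))) (L : Type) (IsCMField.complexConj (L : Type)) 3 1 (Matrix.diagonal (frameD V))
      (Matrix.diagonal (lineVec (L : Type) a)) (complexConj_imagUnit (L : Type)) (imagUnit_ne_zero (L : Type)) (imagUnit_mul_self (L : Type))
      (realDiagonal_isSymm (L : Type) (frameD V) (frameD_real V)) (realDiagonal_isSymm (L : Type) (lineVec (L : Type) a) (fun _ => ha))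
      (isUnit_det_realDiagonal (L : Type) (frameD V) (frameD_real V) (frameD_ne V))
      (isUnit_det_realDiagonal (L : Type) (lineVec (L : Type) a) (fun _ => ha) (fun _ => ha0))
      (realDiagonal_map (L : Type) (frameD V) (frameD_real V)).symm (realDiagonal_map (L : Type) (lineVec (L : Type) a) (fun _ => ha)).symm e₁
      _ hsμ htw (proj_twist_splittingOf V a ha ha0 hGR ĉ)]
  -- §1: the twist contributes `ĉ(ι_W (a′)_𝔸)` …
  have htwist := archWeilRep_twist_one_left (↥(maximalRealSubfield (L : Type))) (L : Type) (IsCMField.complexConj (L : Type)) 3 1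
      (Matrix.diagonal (frameD V)) (Matrix.diagonal (lineVec (L : Type) a)) (complexConj_imagUnit (L : Type)) (imagUnit_ne_zero (L : Type))
      (imagUnit_mul_self (L : Type)) (realDiagonal_isSymm (L : Type) (frameD V) (frameD_real V))
      (realDiagonal_isSymm (L : Type) (lineVec (L : Type) a) (fun _ => ha))
      (isUnit_det_realDiagonal (L : Type) (frameD V) (frameD_real V) (frameD_ne V))
      (isUnit_det_realDiagonal (L : Type) (lineVec (L : Type) a) (fun _ => ha) (fun _ => ha0))
      (realDiagonal_map (L : Type) (frameD V) (frameD_real V)).symm (realDiagonal_map (L : Type) (lineVec (L : Type) a) (fun _ => ha)).symm e₁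
      (cmSplittingOf (L : Type) e₁ (frameD V) (frameD_real V) (frameD_ne V) (lineVec (L : Type) a) (fun _ => ha) (fun _ => ha0) hGR)
      (proj_cmSplittingOf (L : Type) e₁ (frameD V) (frameD_real V) (frameD_ne V) (lineVec (L : Type) a) (fun _ => ha) (fun _ => ha0) hGR)
      ĉ (proj_twist_splittingOf V a ha ha0 hGR ĉ) a'
      (blockFamilyOfAt (L : Type) e₁ (frameD V) (frameD_real V) (frameD_ne V) (lineVec (L : Type) a) (fun _ => ha) (fun _ => ha0) ι₁
        (blockPosEquiv V) (blockNegEquiv V) eR eS (degOnePDual S') (binvPi 1) ℓ)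
  -- … and ★ the centre row: `s₀` contributes `(ĉ (ι_W (a′)_𝔸))⁻¹` (weight one ∕ admissibility ∕ orientation)
  have hrow := cmArchWeilRep_one_blockFamilyOfAt_eq_inv_twistChar_smul V a ha ha0 hGR μ₀ hμ₀ hw hΦμ hΦ hι₁ ĉ htw eR eS a' ℓ
  rw [hrow, smul_smul, Units.mul_inv, one_smul] at htwist
  exact htwist

include hw htw in
set_option synthInstance.maxHeartbeats 400000 in
set_option maxHeartbeats 8000000 in
/-- **Row (E) under the ENGINE's admissible-line binders** (`e` admissible for `Φ_{μ₀} = hμ₀.cmType`, `a = e·2δ`, orientation `(mk ι₁).embedding ∈ Φ_{μ₀}`, exactly as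
★ `F0P2sThetaOccursInEngineGen.exists_holTheta_atFrame_of_chiN` ∕ ★ `F0P2tThetaLiftNeZeroGen` read them): `archWeilRep[chiSplitting(μ₀)] (1, a′) Φ_∞(ℓ) = Φ_∞(ℓ)`.
The CM type of `μ₀` is `{φ ∣ Im φ(δ·a) > 0}` by ★ `AdmissibleLine.IsAdmissibleElement.mem_iff_im_pos`.
[cite: Liu2021, Def. 4.12; App. D §D.1 Step 3 (l. 5219–5221), Lem. D.2 (2)] [cite: GelbartRogawski1991, §3.1 Remark p. 457 L4–13] [cite: KonnoKonno2007, Thm 5.4 p. 75] -/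
theorem archWeilRep_chiSplitting_one_blockFamilyOfAt_eq_self_of_admissible
    (e : (L : Type)) (he : IsAdmissibleElement (L : Type) hμ₀.cmType.1 e) (hae : a = e * (2 * imagUnit (L : Type)))
    (hmem : (InfinitePlace.mk ι₁).embedding ∈ hμ₀.cmType.1)
    (a' : UnitaryGroup.arch (↥(maximalRealSubfield L)) (L : Type) (IsCMField.complexConj L) 1 (Matrix.diagonal (lineVec (L : Type) a)))
    (ℓ : Module.Dual ℂ (Fin 2 → ℂ)) :
    archWeilRep (↥(maximalRealSubfield (L : Type))) (L : Type) (IsCMField.complexConj (L : Type)) 3 1 (Matrix.diagonal (frameD V))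
        (Matrix.diagonal (lineVec (L : Type) a)) (complexConj_imagUnit (L : Type)) (imagUnit_ne_zero (L : Type)) (imagUnit_mul_self (L : Type))
        (realDiagonal_isSymm (L : Type) (frameD V) (frameD_real V)) (realDiagonal_isSymm (L : Type) (lineVec (L : Type) a) (fun _ => ha))
        (isUnit_det_realDiagonal (L : Type) (frameD V) (frameD_real V) (frameD_ne V))
        (isUnit_det_realDiagonal (L : Type) (lineVec (L : Type) a) (fun _ => ha) (fun _ => ha0))
        (realDiagonal_map (L : Type) (frameD V) (frameD_real V)).symm (realDiagonal_map (L : Type) (lineVec (L : Type) a) (fun _ => ha)).symm e₁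
        (chiSplitting (L : Type) e₁ (frameD V) (frameD_real V) (frameD_ne V) (lineVec (L : Type) a) (fun _ => ha) (fun _ => ha0)
          (toHeckeCharacter (L : Type) μ₀) (isUnitary_toHeckeCharacter (L : Type) μ₀)
          (isSplittingChar_toHeckeCharacter_of_isConjugateSymplectic (L : Type) μ₀ hμ₀)) hsμ (1, a')
        (blockFamilyOfAt (L : Type) e₁ (frameD V) (frameD_real V) (frameD_ne V) (lineVec (L : Type) a) (fun _ => ha) (fun _ => ha0) ι₁
          (blockPosEquiv V) (blockNegEquiv V) eR eS (degOnePDual S') (binvPi 1) ℓ) =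
      blockFamilyOfAt (L : Type) e₁ (frameD V) (frameD_real V) (frameD_ne V) (lineVec (L : Type) a) (fun _ => ha) (fun _ => ha0) ι₁
        (blockPosEquiv V) (blockNegEquiv V) eR eS (degOnePDual S') (binvPi 1) ℓ :=
  archWeilRep_chiSplitting_one_blockFamilyOfAt_eq_self V a ha ha0 hGR μ₀ hμ₀ hw ĉ htw hsμ eR eS hμ₀.hasCMType_cmType
    (fun φ => by
      rw [hae]
      exact AdmissibleLine.IsAdmissibleElement.mem_iff_im_pos hμ₀.cmType he (complexConj_imagUnit _) (imagUnit_ne_zero _) φ)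
    hmem a' ℓ

include hw htw in
set_option synthInstance.maxHeartbeats 400000 in
set_option maxHeartbeats 8000000 in
/-- **The two #20a conjuncts «(E) ∧ `R^∞φ_{j₀} ≠ 0`» for the transported archimedean vector `Φ_∞(ℓ₀)`, `ℓ₀ = ⟨e₀, ·⟩`**, under the engine's
admissible-line binders: every `a′ ∈ U(⟨a⟩)(L⁺ ⊗ ℝ)` fixes `Φ_∞(ℓ₀)` under `archWeilRep[chiSplitting(μ₀)]`, and `Φ_∞(ℓ₀) ≠ 0` (★
`ArchSideTerm.blockFamilyOfAt_degOnePDual_binvPi_one_ne_zero`).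
[cite: Liu2021, App. D §D.1 Step 3 (l. 5219–5221), Lem. D.2 (2); proof of Prop. 4.13 «Conversely» (l. 2145–2149)] [cite: KonnoKonno2007, Lemma 5.2, Thm 5.4 p. 75]
[cite: GelbartRogawski1991, §3.1 Remark p. 457 L4–13] -/
theorem archRowE_and_ne_zero_of_admissible
    (e : (L : Type)) (he : IsAdmissibleElement (L : Type) hμ₀.cmType.1 e) (hae : a = e * (2 * imagUnit (L : Type)))
    (hmem : (InfinitePlace.mk ι₁).embedding ∈ hμ₀.cmType.1) :
    (∀ a' : UnitaryGroup.arch (↥(maximalRealSubfield L)) (L : Type) (IsCMField.complexConj L) 1 (Matrix.diagonal (lineVec (L : Type) a)),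
      archWeilRep (↥(maximalRealSubfield (L : Type))) (L : Type) (IsCMField.complexConj (L : Type)) 3 1 (Matrix.diagonal (frameD V))
          (Matrix.diagonal (lineVec (L : Type) a)) (complexConj_imagUnit (L : Type)) (imagUnit_ne_zero (L : Type)) (imagUnit_mul_self (L : Type))
          (realDiagonal_isSymm (L : Type) (frameD V) (frameD_real V)) (realDiagonal_isSymm (L : Type) (lineVec (L : Type) a) (fun _ => ha))
          (isUnit_det_realDiagonal (L : Type) (frameD V) (frameD_real V) (frameD_ne V))
          (isUnit_det_realDiagonal (L : Type) (lineVec (L : Type) a) (fun _ => ha) (fun _ => ha0))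
          (realDiagonal_map (L : Type) (frameD V) (frameD_real V)).symm (realDiagonal_map (L : Type) (lineVec (L : Type) a) (fun _ => ha)).symm e₁
          (chiSplitting (L : Type) e₁ (frameD V) (frameD_real V) (frameD_ne V) (lineVec (L : Type) a) (fun _ => ha) (fun _ => ha0)
            (toHeckeCharacter (L : Type) μ₀) (isUnitary_toHeckeCharacter (L : Type) μ₀)
            (isSplittingChar_toHeckeCharacter_of_isConjugateSymplectic (L : Type) μ₀ hμ₀)) hsμ (1, a')
          (blockFamilyOfAt (L : Type) e₁ (frameD V) (frameD_real V) (frameD_ne V) (lineVec (L : Type) a) (fun _ => ha) (fun _ => ha0) ι₁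
            (blockPosEquiv V) (blockNegEquiv V) eR eS (degOnePDual S') (binvPi 1) (dotProductEquiv ℂ (Fin 2) (Pi.single 0 1))) =
        blockFamilyOfAt (L : Type) e₁ (frameD V) (frameD_real V) (frameD_ne V) (lineVec (L : Type) a) (fun _ => ha) (fun _ => ha0) ι₁
          (blockPosEquiv V) (blockNegEquiv V) eR eS (degOnePDual S') (binvPi 1) (dotProductEquiv ℂ (Fin 2) (Pi.single 0 1))) ∧
      blockFamilyOfAt (L : Type) e₁ (frameD V) (frameD_real V) (frameD_ne V) (lineVec (L : Type) a) (fun _ => ha) (fun _ => ha0) ι₁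
          (blockPosEquiv V) (blockNegEquiv V) eR eS (degOnePDual S') (binvPi 1) (dotProductEquiv ℂ (Fin 2) (Pi.single 0 1)) ≠ 0 :=
  ⟨fun a' => archWeilRep_chiSplitting_one_blockFamilyOfAt_eq_self_of_admissible V a ha ha0 hGR μ₀ hμ₀ hw ĉ htw hsμ eR eS e he hae hmem a' _,
    ArchSideTerm.blockFamilyOfAt_degOnePDual_binvPi_one_ne_zero S' (L : Type) e₁ (frameD V) (frameD_real V) (frameD_ne V) (lineVec (L : Type) a)
      (fun _ => ha) (fun _ => ha0) ι₁ (blockPosEquiv V) (blockNegEquiv V) eR eS⟩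

end Model

end Summit.HodgeConjecture.HodgeConjecture.Cruxes.H413.K2E2CapArchPairFixedNeZero

end
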